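import Summits.AtomisticToContinuum.BoseEinsteinCondensation.Theorems.BECConjugateDominationInfraredMinimumUncertaintyFSum
import Literature.MathematicalPhysics.QuantumManyBody.PeriodicBoseGasLemma33

/-!
# Route `BECConjugateDomination`, crux `InfraredMinimumUncertainty` (stmt-AtomisticToContinuum-11784),
# line `fisher-gaussian-density-mode`: the derivative-free (Stein) form of the lifted Fisher test functional

Supports (does not close) stmt-AtomisticToContinuum-11784; NEW (line lead, attack on the registered stub
`stub_phaseFisherDomination`). For a real-valued periodic `C¹` state `Ψ` and a `C¹` test field
`φ : ℂ → ℂ` (Wirtinger derivatives `∂φ = ½(∂ₓφ − i∂_yφ)`, `∂̄φ = ½(∂ₓφ + i∂_yφ)`, written out through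
`fderiv ℝ φ z 1` and `fderiv ℝ φ z I`):

* `fderiv_steinFlux`, `stein_step`: periodic integration by parts of the flux `conj(φ(Z)) e_m(x_j) u²` along
  the density-wave direction `Pi.single j k` (using `∂_{x_j·k} Z_m = i‖k‖² e_m(x_j)`, `|e|² = 1`, `e_m² = e_{2m}`)
  turns `∫ conj(φ(Z)) e_m(x_j)(‖k‖²u − 2i∂_{x_j·k}u) u` into `‖k‖²∫conj(∂φ(Z))u² − ‖k‖²∫conj(∂̄φ(Z)) e_{2m}(x_j) u²`;
* `stein_step`: the per-particle integrated form; the assembly over particles (`stein_identity`) and the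
  derivative-free form of `J_m(φ)` (`fisherTestV_eq_stein`) are in `…SteinForm.lean`.

Consequence for the line: the lifted Fisher test functional — hence both registered stubs FD
(`16 ν_m ≤ C J_m(φ)`) and FG (`J_m(φ)·N S_m ≤ C`) — depends on the state ONLY through the Lévy weight
`ν_m` and the JOINT LAW of the first two harmonics `(Z_m, Z_{2m})` of the empirical density under
`|Ψ|² dX`; no derivative of `Ψ` survives (the linear field `φ = −λz` recovers the f-sum/Cramér–Rao rung
`J = 4λ − λ² N S_m`; the antilinear field `φ = −λz̄` tests `E[Z_{2m}]`). Tools: `integral_cellN_fderiv_single_eq_zero_complex`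
(complex-valued periodic by parts), `fderiv_apply_eq_wirtinger` (`Dφ·w = ∂φ w + ∂̄φ w̄`).

References: C. Stein, Proc. Sixth Berkeley Symp. 2 (1972) 583 (Stein identities); A. J. Stam, Inform.
Control 2 (1959) 101; Bakry–Gentil–Ledoux (2014) §1.11.3 (integration by parts on the torus).
-/

noncomputable section

open MeasureTheory Filter Set Metric
open scoped ENNReal NNReal Topology ComplexConjugate BigOperators

namespace Summit.AtomisticToContinuum.BoseEinsteinCondensation.Cruxes.InfraredMinimumUncertainty.FisherGaussianDensityMode

open Literature.MathematicalPhysics.QuantumManyBody.BoseGas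

/-! ## Complex-valued periodic integration by parts and the Wirtinger split -/

section Stein

variable {N : ℕ}

/-- **Directional periodic integration by parts, complex-valued**: `∫_{cell^N} ∂_{x_j·w} G = 0` for a
`C¹` complex-valued function that is `Lℤ³`-periodic in every particle. -/
theorem integral_cellN_fderiv_single_eq_zero_complex {L : ℝ} (hL : 0 < L) {G : Config N → ℂ}
    (hG : ContDiff ℝ 1 G)
    (hper : ∀ (X : Config N) (i : Fin N) (c : Fin 3), G (X + Pi.single i (EuclideanSpace.single c L)) = G X)
    (j : Fin N) (w : Space) :
    ∫ X in cellN N L, fderiv ℝ G X (Pi.single j w) = 0 := by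
  -- real and imaginary parts
  have hre_cd : ContDiff ℝ 1 (fun X => (G X).re) := Complex.reCLM.contDiff.comp hG
  have him_cd : ContDiff ℝ 1 (fun X => (G X).im) := Complex.imCLM.contDiff.comp hG
  have hre_per : IsLatticePeriodic L (fun X => (G X).re) := fun X i c => by
    show (G (X + Pi.single i (EuclideanSpace.single c L))).re = (G X).re
    rw [hper X i c]
  have him_per : IsLatticePeriodic L (fun X => (G X).im) := fun X i c => by
    show (G (X + Pi.single i (EuclideanSpace.single c L))).im = (G X).im
    rw [hper X i c]
  have hGd : Differentiable ℝ G := hG.differentiable one_ne_zero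
  have hsplit : ∀ X, fderiv ℝ G X (Pi.single j w) =
      ((fderiv ℝ (fun X => (G X).re) X (Pi.single j w) : ℝ) : ℂ) +
        ((fderiv ℝ (fun X => (G X).im) X (Pi.single j w) : ℝ) : ℂ) * Complex.I := by
    intro X
    have hGX := (hGd X).hasFDerivAt
    have h1 : HasFDerivAt (fun X => (G X).re) (Complex.reCLM.comp (fderiv ℝ G X)) X :=
      Complex.reCLM.hasFDerivAt.comp X hGX
    have h2 : HasFDerivAt (fun X => (G X).im) (Complex.imCLM.comp (fderiv ℝ G X)) X :=
      Complex.imCLM.hasFDerivAt.comp X hGX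
    rw [h1.fderiv, h2.fderiv]
    simp only [ContinuousLinearMap.comp_apply, Complex.reCLM_apply, Complex.imCLM_apply]
    exact (Complex.re_add_im _).symm
  simp_rw [hsplit]
  have hc1 : Continuous fun X => fderiv ℝ (fun X => (G X).re) X (Pi.single j w) :=
    (hre_cd.continuous_fderiv one_ne_zero).clm_apply continuous_const
  have hc2 : Continuous fun X => fderiv ℝ (fun X => (G X).im) X (Pi.single j w) :=
    (him_cd.continuous_fderiv one_ne_zero).clm_apply continuous_const
  have hi1 : IntegrableOn (fun X => ((fderiv ℝ (fun X => (G X).re) X (Pi.single j w) : ℝ) : ℂ))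
      (cellN N L) volume := integrableOn_cellN (Complex.continuous_ofReal.comp hc1) L
  have hi2 : IntegrableOn (fun X => ((fderiv ℝ (fun X => (G X).im) X (Pi.single j w) : ℝ) : ℂ) * Complex.I)
      (cellN N L) volume := (integrableOn_cellN (Complex.continuous_ofReal.comp hc2) L).mul_const _
  rw [integral_add hi1 hi2, integral_mul_const, integral_complex_ofReal, integral_complex_ofReal,
    integral_cellN_fderiv_single_eq_zero hL hre_cd hre_per j w,
    integral_cellN_fderiv_single_eq_zero hL him_cd him_per j w]
  simp

/-- Real-linear decomposition of the derivative of a map `ℂ → ℂ` along a complex direction, in Wirtinger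
form: `Dφ(z)·w = ∂φ(z) w + ∂̄φ(z) w̄`. -/
theorem fderiv_apply_eq_wirtinger : ∀ (φ : ℂ → ℂ) (z w : ℂ),
    fderiv ℝ φ z w =
      ((fderiv ℝ φ z 1 - Complex.I * fderiv ℝ φ z Complex.I) / 2) * w +
        ((fderiv ℝ φ z 1 + Complex.I * fderiv ℝ φ z Complex.I) / 2) * starRingEnd ℂ w := by
  intro φ z w
  have hw : w = (w.re : ℂ) + (w.im : ℂ) * Complex.I := (Complex.re_add_im w).symm
  have hlin : fderiv ℝ φ z w = (w.re : ℂ) * fderiv ℝ φ z 1 + (w.im : ℂ) * fderiv ℝ φ z Complex.I := by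
    conv_lhs => rw [hw]
    rw [map_add]
    have h1 : fderiv ℝ φ z ((w.re : ℂ)) = (w.re : ℂ) * fderiv ℝ φ z 1 := by
      rw [show ((w.re : ℂ)) = (w.re : ℝ) • (1 : ℂ) by simp, map_smul]; simp
    have h2 : fderiv ℝ φ z ((w.im : ℂ) * Complex.I) = (w.im : ℂ) * fderiv ℝ φ z Complex.I := by
      rw [show ((w.im : ℂ) * Complex.I) = (w.im : ℝ) • Complex.I by simp, map_smul]; simp
    rw [h1, h2]
  rw [hlin]
  apply Complex.ext
  · simp only [Complex.add_re, Complex.mul_re, Complex.ofReal_re, Complex.ofReal_im, Complex.div_ofNat_re,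
      Complex.sub_re, Complex.I_re, Complex.I_im, Complex.div_ofNat_im, Complex.sub_im, Complex.mul_im,
      Complex.add_im, Complex.conj_re, Complex.conj_im]
    ring
  · simp only [Complex.add_im, Complex.mul_im, Complex.ofReal_re, Complex.ofReal_im, Complex.div_ofNat_re,
      Complex.sub_re, Complex.I_re, Complex.I_im, Complex.div_ofNat_im, Complex.sub_im, Complex.mul_re,
      Complex.add_re, Complex.conj_re, Complex.conj_im]
    ring

/-- `conj(e) * e = 1` for a plane wave. -/
theorem conj_cellWave_mul_self (L : ℝ) (m : Fin 3 → ℤ) (x : Space) :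
    starRingEnd ℂ (cellWave L m x) * cellWave L m x = 1 := by
  rw [← Complex.normSq_eq_conj_mul_self, Complex.normSq_eq_norm_sq, norm_cellWave]
  simp

/-- `e_m(x)² = e_{2m}(x)`. -/
theorem cellWave_sq (L : ℝ) (m : Fin 3 → ℤ) (x : Space) :
    cellWave L m x * cellWave L m x = cellWave L ((2 : ℕ) • m) x := by
  rw [two_nsmul, cellWave_add_index]

/-- Pure algebra behind the Stein step: with `Dφ·w = a w + b w̄`, `conj(e) e = 1`, `e e = e₂`,
the integrand `P e (κ u − 2i u') u` equals `−i·G' + κ conj(a) u² − κ conj(b) e₂ u²` where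
`G' = conj(a (iκe) + b conj(iκe)) e u² + P (iκ e) u² + P e (2 u u')` is the derivative of the flux. -/
theorem stein_algebra (P e e₂ a b : ℂ) (κ u u' : ℝ) (he : starRingEnd ℂ e * e = 1) (he₂ : e * e = e₂) :
    P * (e * (((κ : ℝ) : ℂ) * ((u : ℝ) : ℂ) - 2 * Complex.I * ((u' : ℝ) : ℂ))) * ((u : ℝ) : ℂ) =
      -Complex.I * (starRingEnd ℂ (a * (Complex.I * ((κ : ℝ) : ℂ) * e) +
          b * starRingEnd ℂ (Complex.I * ((κ : ℝ) : ℂ) * e)) * e * ((u ^ 2 : ℝ) : ℂ) +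
        P * (Complex.I * ((κ : ℝ) : ℂ) * e) * ((u ^ 2 : ℝ) : ℂ) +
        P * e * ((2 * u * u' : ℝ) : ℂ)) +
      ((κ : ℝ) : ℂ) * (starRingEnd ℂ a * ((u ^ 2 : ℝ) : ℂ)) -
      ((κ : ℝ) : ℂ) * (starRingEnd ℂ b * e₂ * ((u ^ 2 : ℝ) : ℂ)) := by
  simp only [map_add, map_mul, map_neg, Complex.conj_I, Complex.conj_ofReal,
    Complex.conj_conj]
  push_cast
  linear_combination ((κ : ℂ) * starRingEnd ℂ a * (u : ℂ) ^ 2) * he +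
    (-(κ : ℂ) * starRingEnd ℂ b * (u : ℂ) ^ 2) * he₂ +
    ((κ : ℂ) * P * e * (u : ℂ) ^ 2 - (κ : ℂ) * starRingEnd ℂ a * (starRingEnd ℂ e * e) * (u : ℂ) ^ 2 +
      (κ : ℂ) * starRingEnd ℂ b * (e * e) * (u : ℂ) ^ 2) * Complex.I_mul_I

/-- `z ↦ ∂φ(z) = ½(∂ₓφ − i∂_yφ)` is continuous for a `C¹` field. -/
theorem continuous_wirtingerD {φ : ℂ → ℂ} (hφ : ContDiff ℝ 1 φ) :
    Continuous fun z => (fderiv ℝ φ z 1 - Complex.I * fderiv ℝ φ z Complex.I) / 2 := by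
  have h1 : Continuous fun z => fderiv ℝ φ z 1 := (hφ.continuous_fderiv one_ne_zero).clm_apply continuous_const
  have h2 : Continuous fun z => fderiv ℝ φ z Complex.I :=
    (hφ.continuous_fderiv one_ne_zero).clm_apply continuous_const
  exact (h1.sub (continuous_const.mul h2)).div_const _

/-- `z ↦ ∂̄φ(z) = ½(∂ₓφ + i∂_yφ)` is continuous for a `C¹` field. -/
theorem continuous_wirtingerDbar {φ : ℂ → ℂ} (hφ : ContDiff ℝ 1 φ) :
    Continuous fun z => (fderiv ℝ φ z 1 + Complex.I * fderiv ℝ φ z Complex.I) / 2 := by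
  have h1 : Continuous fun z => fderiv ℝ φ z 1 := (hφ.continuous_fderiv one_ne_zero).clm_apply continuous_const
  have h2 : Continuous fun z => fderiv ℝ φ z Complex.I :=
    (hφ.continuous_fderiv one_ne_zero).clm_apply continuous_const
  exact (h1.add (continuous_const.mul h2)).div_const _

/-- The derivative of the Stein flux `G = conj(φ(Z)) e_j u²` along the density wave `Pi.single j k`. -/
theorem fderiv_steinFlux {L : ℝ} (m : Fin 3 → ℤ) {u : Config N → ℝ} (hu : ContDiff ℝ 1 u)
    {φ : ℂ → ℂ} (hφ : ContDiff ℝ 1 φ) (j : Fin N) (X : Config N) :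
    fderiv ℝ (fun Y : Config N => starRingEnd ℂ (φ (densityMode N L m Y)) * cellWave L m (Y j) *
        ((u Y ^ 2 : ℝ) : ℂ)) X (Pi.single j (waveVec L m)) =
      starRingEnd ℂ (fderiv ℝ φ (densityMode N L m X)
          (Complex.I * ((‖waveVec L m‖ ^ 2 : ℝ) : ℂ) * cellWave L m (X j))) * cellWave L m (X j) *
          ((u X ^ 2 : ℝ) : ℂ) +
        starRingEnd ℂ (φ (densityMode N L m X)) *
          (Complex.I * ((‖waveVec L m‖ ^ 2 : ℝ) : ℂ) * cellWave L m (X j)) * ((u X ^ 2 : ℝ) : ℂ) +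
        starRingEnd ℂ (φ (densityMode N L m X)) * cellWave L m (X j) *
          ((2 * u X * fderiv ℝ u X (Pi.single j (waveVec L m)) : ℝ) : ℂ) := by
  have hφd : Differentiable ℝ φ := hφ.differentiable one_ne_zero
  have hZd : Differentiable ℝ (densityMode N L m) := (contDiff_densityMode N L m).differentiable one_ne_zero
  have hud : Differentiable ℝ u := hu.differentiable one_ne_zero
  have hA0 : HasFDerivAt (fun Y => φ (densityMode N L m Y))
      ((fderiv ℝ φ (densityMode N L m X)).comp (fderiv ℝ (densityMode N L m) X)) X :=
    (hφd (densityMode N L m X)).hasFDerivAt.comp X (hZd X).hasFDerivAt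
  have hA : HasFDerivAt (fun Y => star (φ (densityMode N L m Y)))
      (((starL' ℝ : ℂ ≃L[ℝ] ℂ) : ℂ →L[ℝ] ℂ).comp
        ((fderiv ℝ φ (densityMode N L m X)).comp (fderiv ℝ (densityMode N L m) X))) X := hA0.star
  have hB : HasFDerivAt (fun Y : Config N => cellWave L m (Y j))
      (fderiv ℝ (fun Y : Config N => cellWave L m (Y j)) X) X :=
    (differentiableAt_cellWave_comp_apply L m j X).hasFDerivAt
  have hC0 : HasFDerivAt (fun Y => u Y * u Y) (u X • fderiv ℝ u X + u X • fderiv ℝ u X) X :=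
    (hud X).hasFDerivAt.mul (hud X).hasFDerivAt
  have hC : HasFDerivAt (fun Y => ((u Y ^ 2 : ℝ) : ℂ))
      (Complex.ofRealCLM.comp (u X • fderiv ℝ u X + u X • fderiv ℝ u X)) X := by
    have h := Complex.ofRealCLM.hasFDerivAt.comp X hC0
    have hfun : (fun Y => ((u Y ^ 2 : ℝ) : ℂ)) = (⇑Complex.ofRealCLM ∘ fun Y => u Y * u Y) := by
      funext Y
      simp [sq]
    rw [hfun]
    exact h
  have hG : HasFDerivAt (fun Y : Config N => starRingEnd ℂ (φ (densityMode N L m Y)) * cellWave L m (Y j) *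
      ((u Y ^ 2 : ℝ) : ℂ)) _ X := (hA.mul hB).mul hC
  rw [hG.fderiv]
  simp only [FunLike.coe_add, Pi.add_apply, FunLike.coe_smul, Pi.smul_apply,
    smul_eq_mul, ContinuousLinearMap.comp_apply, ContinuousLinearEquiv.coe_coe, starL'_apply,
    Complex.star_def, Complex.ofRealCLM_apply, Pi.mul_apply]
  rw [fderiv_cellWave_comp_apply_waveVec, if_pos rfl, fderiv_densityMode_waveVec]
  push_cast
  ring

/-- The Stein flux is `C¹`. -/
theorem contDiff_steinFlux {L : ℝ} (m : Fin 3 → ℤ) {u : Config N → ℝ} (hu : ContDiff ℝ 1 u)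
    {φ : ℂ → ℂ} (hφ : ContDiff ℝ 1 φ) (j : Fin N) :
    ContDiff ℝ 1 (fun Y : Config N => starRingEnd ℂ (φ (densityMode N L m Y)) * cellWave L m (Y j) *
        ((u Y ^ 2 : ℝ) : ℂ)) := by
  have h1 : ContDiff ℝ 1 (fun Y : Config N => starRingEnd ℂ (φ (densityMode N L m Y))) :=
    Complex.conjCLE.contDiff.comp (hφ.comp (contDiff_densityMode N L m))
  have h3 : ContDiff ℝ 1 (fun Y : Config N => ((u Y ^ 2 : ℝ) : ℂ)) :=
    Complex.ofRealCLM.contDiff.comp (hu.pow 2)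
  exact (h1.mul (contDiff_cellWave_comp_apply L m j)).mul h3

/-- **Stein step** (per particle `j`): periodic integration by parts of the flux `conj(φ(Z)) e_j u²`
along `Pi.single j k` turns `∫ conj(φ(Z)) e_j (‖k‖² u − 2i ∂_{x_j·k}u) u` into
`‖k‖² ∫ conj(∂φ(Z)) u² − ‖k‖² ∫ conj(∂̄φ(Z)) e_{2m}(x_j) u²`. -/
theorem stein_step {L : ℝ} (hL : 0 < L) (m : Fin 3 → ℤ) {u : Config N → ℝ} (hu : ContDiff ℝ 1 u)
    (hper : IsLatticePeriodic L u) {φ : ℂ → ℂ} (hφ : ContDiff ℝ 1 φ) (j : Fin N) :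
    ∫ X in cellN N L, starRingEnd ℂ (φ (densityMode N L m X)) *
        (cellWave L m (X j) * (((‖waveVec L m‖ ^ 2 : ℝ) : ℂ) * ((u X : ℝ) : ℂ) -
          2 * Complex.I * ((fderiv ℝ u X (Pi.single j (waveVec L m)) : ℝ) : ℂ))) * ((u X : ℝ) : ℂ) =
      ((‖waveVec L m‖ ^ 2 : ℝ) : ℂ) *
          (∫ X in cellN N L, starRingEnd ℂ (((fderiv ℝ φ (densityMode N L m X) 1 - Complex.I * fderiv ℝ φ (densityMode N L m X) Complex.I) / 2)) * ((u X ^ 2 : ℝ) : ℂ)) -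
        ((‖waveVec L m‖ ^ 2 : ℝ) : ℂ) *
          (∫ X in cellN N L, starRingEnd ℂ (((fderiv ℝ φ (densityMode N L m X) 1 + Complex.I * fderiv ℝ φ (densityMode N L m X) Complex.I) / 2)) *
            cellWave L ((2 : ℕ) • m) (X j) * ((u X ^ 2 : ℝ) : ℂ)) := by
  -- by parts for the flux
  have hG_cd := contDiff_steinFlux (L := L) m hu hφ j
  have hG_per : ∀ (X : Config N) (i : Fin N) (c : Fin 3),
      (fun Y : Config N => starRingEnd ℂ (φ (densityMode N L m Y)) * cellWave L m (Y j) * ((u Y ^ 2 : ℝ) : ℂ))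
          (X + Pi.single i (EuclideanSpace.single c L)) =
        (fun Y : Config N => starRingEnd ℂ (φ (densityMode N L m Y)) * cellWave L m (Y j) * ((u Y ^ 2 : ℝ) : ℂ)) X := by
    intro X i c
    simp only [densityMode_periodic hL.ne' m X i c, cellWave_comp_apply_periodic hL.ne' m j X i c, hper X i c]
  have hbp := integral_cellN_fderiv_single_eq_zero_complex hL hG_cd hG_per j (waveVec L m)
  simp_rw [fderiv_steinFlux m hu hφ j] at hbp
  -- pointwise algebra
  have hpt : ∀ X : Config N, starRingEnd ℂ (φ (densityMode N L m X)) *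
        (cellWave L m (X j) * (((‖waveVec L m‖ ^ 2 : ℝ) : ℂ) * ((u X : ℝ) : ℂ) -
          2 * Complex.I * ((fderiv ℝ u X (Pi.single j (waveVec L m)) : ℝ) : ℂ))) * ((u X : ℝ) : ℂ) =
      -Complex.I * (starRingEnd ℂ (fderiv ℝ φ (densityMode N L m X)
          (Complex.I * ((‖waveVec L m‖ ^ 2 : ℝ) : ℂ) * cellWave L m (X j))) * cellWave L m (X j) *
          ((u X ^ 2 : ℝ) : ℂ) +
        starRingEnd ℂ (φ (densityMode N L m X)) *
          (Complex.I * ((‖waveVec L m‖ ^ 2 : ℝ) : ℂ) * cellWave L m (X j)) * ((u X ^ 2 : ℝ) : ℂ) +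
        starRingEnd ℂ (φ (densityMode N L m X)) * cellWave L m (X j) *
          ((2 * u X * fderiv ℝ u X (Pi.single j (waveVec L m)) : ℝ) : ℂ)) +
      ((‖waveVec L m‖ ^ 2 : ℝ) : ℂ) * (starRingEnd ℂ (((fderiv ℝ φ (densityMode N L m X) 1 - Complex.I * fderiv ℝ φ (densityMode N L m X) Complex.I) / 2)) * ((u X ^ 2 : ℝ) : ℂ)) -
      ((‖waveVec L m‖ ^ 2 : ℝ) : ℂ) * (starRingEnd ℂ (((fderiv ℝ φ (densityMode N L m X) 1 + Complex.I * fderiv ℝ φ (densityMode N L m X) Complex.I) / 2)) *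
        cellWave L ((2 : ℕ) • m) (X j) * ((u X ^ 2 : ℝ) : ℂ)) := by
    intro X
    rw [fderiv_apply_eq_wirtinger]
    exact stein_algebra _ _ _ _ _ _ _ _ (conj_cellWave_mul_self L m (X j)) (cellWave_sq L m (X j))
  simp_rw [hpt]
  -- integrability
  have hZc := continuous_densityMode N L m
  have hec : Continuous fun Y : Config N => cellWave L m (Y j) :=
    (contDiff_cellWave L m).continuous.comp (continuous_apply j)
  have he2c : Continuous fun Y : Config N => cellWave L ((2 : ℕ) • m) (Y j) :=
    (contDiff_cellWave L _).continuous.comp (continuous_apply j)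
  have huc : Continuous u := hu.continuous
  have hu2c : Continuous fun Y : Config N => ((u Y ^ 2 : ℝ) : ℂ) := Complex.continuous_ofReal.comp (huc.pow 2)
  have hφc : Continuous fun Y : Config N => starRingEnd ℂ (φ (densityMode N L m Y)) :=
    Complex.continuous_conj.comp (hφ.continuous.comp hZc)
  have hG'c : Continuous fun X : Config N => starRingEnd ℂ (fderiv ℝ φ (densityMode N L m X)
          (Complex.I * ((‖waveVec L m‖ ^ 2 : ℝ) : ℂ) * cellWave L m (X j))) * cellWave L m (X j) *
          ((u X ^ 2 : ℝ) : ℂ) +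
        starRingEnd ℂ (φ (densityMode N L m X)) *
          (Complex.I * ((‖waveVec L m‖ ^ 2 : ℝ) : ℂ) * cellWave L m (X j)) * ((u X ^ 2 : ℝ) : ℂ) +
        starRingEnd ℂ (φ (densityMode N L m X)) * cellWave L m (X j) *
          ((2 * u X * fderiv ℝ u X (Pi.single j (waveVec L m)) : ℝ) : ℂ) := by
    have hc := (hG_cd.continuous_fderiv one_ne_zero).clm_apply
      (continuous_const : Continuous fun _ : Config N => (Pi.single j (waveVec L m) : Config N))
    simp_rw [fderiv_steinFlux m hu hφ j] at hc
    exact hc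
  have hAc : Continuous fun X : Config N =>
      ((‖waveVec L m‖ ^ 2 : ℝ) : ℂ) * (starRingEnd ℂ (((fderiv ℝ φ (densityMode N L m X) 1 - Complex.I * fderiv ℝ φ (densityMode N L m X) Complex.I) / 2)) * ((u X ^ 2 : ℝ) : ℂ)) :=
    continuous_const.mul ((Complex.continuous_conj.comp ((continuous_wirtingerD hφ).comp hZc)).mul hu2c)
  have hBc : Continuous fun X : Config N =>
      ((‖waveVec L m‖ ^ 2 : ℝ) : ℂ) * (starRingEnd ℂ (((fderiv ℝ φ (densityMode N L m X) 1 + Complex.I * fderiv ℝ φ (densityMode N L m X) Complex.I) / 2)) *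
        cellWave L ((2 : ℕ) • m) (X j) * ((u X ^ 2 : ℝ) : ℂ)) :=
    continuous_const.mul (((Complex.continuous_conj.comp ((continuous_wirtingerDbar hφ).comp hZc)).mul he2c).mul hu2c)
  have hiG : Integrable (fun X : Config N => -Complex.I * (starRingEnd ℂ (fderiv ℝ φ (densityMode N L m X)
          (Complex.I * ((‖waveVec L m‖ ^ 2 : ℝ) : ℂ) * cellWave L m (X j))) * cellWave L m (X j) *
          ((u X ^ 2 : ℝ) : ℂ) +
        starRingEnd ℂ (φ (densityMode N L m X)) *
          (Complex.I * ((‖waveVec L m‖ ^ 2 : ℝ) : ℂ) * cellWave L m (X j)) * ((u X ^ 2 : ℝ) : ℂ) +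
        starRingEnd ℂ (φ (densityMode N L m X)) * cellWave L m (X j) *
          ((2 * u X * fderiv ℝ u X (Pi.single j (waveVec L m)) : ℝ) : ℂ)))
      (volume.restrict (cellN N L)) := (integrableOn_cellN hG'c L).const_mul (-Complex.I)
  have hiA : Integrable (fun X : Config N =>
      ((‖waveVec L m‖ ^ 2 : ℝ) : ℂ) * (starRingEnd ℂ (((fderiv ℝ φ (densityMode N L m X) 1 - Complex.I * fderiv ℝ φ (densityMode N L m X) Complex.I) / 2)) * ((u X ^ 2 : ℝ) : ℂ)))
      (volume.restrict (cellN N L)) := integrableOn_cellN hAc L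
  have hiB : Integrable (fun X : Config N =>
      ((‖waveVec L m‖ ^ 2 : ℝ) : ℂ) * (starRingEnd ℂ (((fderiv ℝ φ (densityMode N L m X) 1 + Complex.I * fderiv ℝ φ (densityMode N L m X) Complex.I) / 2)) *
        cellWave L ((2 : ℕ) • m) (X j) * ((u X ^ 2 : ℝ) : ℂ))) (volume.restrict (cellN N L)) :=
    integrableOn_cellN hBc L
  have hiF : Integrable (fun X : Config N => -Complex.I * (starRingEnd ℂ (fderiv ℝ φ (densityMode N L m X)
          (Complex.I * ((‖waveVec L m‖ ^ 2 : ℝ) : ℂ) * cellWave L m (X j))) * cellWave L m (X j) *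
          ((u X ^ 2 : ℝ) : ℂ) +
        starRingEnd ℂ (φ (densityMode N L m X)) *
          (Complex.I * ((‖waveVec L m‖ ^ 2 : ℝ) : ℂ) * cellWave L m (X j)) * ((u X ^ 2 : ℝ) : ℂ) +
        starRingEnd ℂ (φ (densityMode N L m X)) * cellWave L m (X j) *
          ((2 * u X * fderiv ℝ u X (Pi.single j (waveVec L m)) : ℝ) : ℂ)) +
      ((‖waveVec L m‖ ^ 2 : ℝ) : ℂ) * (starRingEnd ℂ (((fderiv ℝ φ (densityMode N L m X) 1 - Complex.I * fderiv ℝ φ (densityMode N L m X) Complex.I) / 2)) * ((u X ^ 2 : ℝ) : ℂ)))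
      (volume.restrict (cellN N L)) := hiG.add hiA
  rw [integral_sub hiF hiB, integral_add hiG hiA, integral_const_mul, hbp, mul_zero, zero_add,
    integral_const_mul, integral_const_mul]

end Stein

end Summit.AtomisticToContinuum.BoseEinsteinCondensation.Cruxes.InfraredMinimumUncertainty.FisherGaussianDensityMode

end
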